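import Summits.BirchSwinnertonDyer.BirchSwinnertonDyer.Theorems.GenusKolyvaginAtTwoMinimalTwinBSDTwoOrdinaryTwist
import Summits.BirchSwinnertonDyer.BirchSwinnertonDyer.Theorems.ResidualThetaTransportAtTwoResidualThetaMainConjectureAtTwoHabitatTwoAdicDictionary
import Literature.NumberTheory.EllipticCurves.TwoAdicImageQuadraticTwistProofs
import Literature.NumberTheory.EllipticCurves.IsogenyHasCMIffJMemProofs
import HarnessLib

/-!
# Route `AlignedTransportAtTwo`, crux C2 `MainConjectureOfRankZeroBSDAtTwo` (stmt-BirchSwinnertonDyer-22298):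
# THE CM EXCLUSION ON THE GOOD-ORDINARY-AT-`2` LOCAL CLASS — PROVED
# «a globally minimal elliptic `W/ℚ`, good ORDINARY at `2`, with `W(ℚ)[2] = 0`, has NO complex multiplication»

HONEST FRAMING. WIDTH-5 attached prover seat `bsd-line-att-p4` g37 on line `birth` of the lead `bsd-line-att-p2` (WAKE-only);
`--supports` stmt-BirchSwinnertonDyer-22298 `--as helper`, closes nothing; BSD is NOT proved; crux C2, its verdict «blocked-on
`Rank1Residual.GreenbergMuConjectureIrreducible`», every registered stub (P / T / Kμ / LimDoor / MuIneqʳ / PFμ⁺ of `Lines/birth.lean` v9)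
untouched. THEOREMS ONLY (no `def`, no named-fact hypothesis, no `sorry`); everything here is UNCONDITIONAL; ROUTE-INDEPENDENT imports
(Literature + two Literature-level Theorems helper files), so any cell may import it.

WHY. att-p4 g36's NECESSITY files (`…OrdinaryStandardShapeCMSexticNecessity{,FH}`, p801108 / p801926) carry the «textbook CM exclusion»
as a DISPLAYED hypothesis `hCMex : ∀ W, IsOrdinaryAt W 2 → (∀ x, ¬ HasRationalTwoTorsionX W x) → ¬ IsSquare W.Δ → ¬ W.HasCM`, and the crux
C2 itself carries `¬ W.HasCM` as its first binder next to «good ordinary at `2`» and «`W(ℚ)[2] = 0`». This file PROVES `hCMex` (the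
`Δ`-binder is idle), using the tree THEOREM `WeierstrassCurve.hasCM_iff_j_mem_holds` (Silverman App. C §11: CM over `ℚ` ⟺ `j` is one
of the thirteen class-number-one values; discharged in the tree via Heegner–Stark–Baker, `IsogenyHasCMIffJMemProofs`):

* §1 `twoDivision_eval_eq` — `4x³ + b₂x² + 2b₄x + b₆` at `x = (X − 3b₂)/36` equals `(X³ − 27c₄X − 54c₆)/11664`; `c_relation_of_j_eq` —
  `(j₀ − 1728)c₄³ = j₀c₆²` when `j(W) = j₀`.
* §2 ★ `exists_hasRationalTwoTorsionX_of_j_eq_neg_3375`, ★ `exists_hasRationalTwoTorsionX_of_j_eq_16581375` — EVERY elliptic curve over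
  `ℚ` with `j = −3375` (resp. `255³`), i.e. every twist of `49a1` (resp. `49a2`), has a rational point of order `2`: explicit abscissa
  `x = (s·c₆/c₄ − 3b₂)/36`, `s = 5` (resp. `−170/57`) (any model; pure `c₄, c₆` algebra).
* §3 ★ `odd_of_isOrdinaryAt_two_of_j_eq_intCast` — on a globally minimal equation, good ordinary at `2` and `j = n ∈ ℤ` force `n` odd
  (ordinary ⟺ `a₁` odd, gk2-p3 g6 `isOrdinaryAt_two_iff_odd_a₁`; `c₄ ≡ a₁⁴`, `Δ_min` odd, `n·Δ_min = c₄³`).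
* §4 ★★ `j_eq_or_j_eq_of_hasCM_of_isOrdinaryAt_two` (Deuring at `2` in `j`-currency: CM + good ordinary at `2` ⟹ `j ∈ {−3375, 16581375}`,
  the `ℚ(√−7)` values — the other eleven CM `j`'s are even), ★★ `exists_hasRationalTwoTorsionX_of_hasCM_of_isOrdinaryAt_two`,
  ★★★ `not_hasCM_of_isOrdinaryAt_two_of_forall_not_hasRationalTwoTorsionX`, ★★★ `cmExclusion` (the `hCMex` shape verbatim), and the
  `GoodOrd W 2` currency twins `not_hasCM_of_goodOrd_two_of_forall_not_hasRationalTwoTorsionX`, `exists_hasRationalTwoTorsionX_of_hasCM_of_goodOrd_two`.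

READING (to -imc = planner-of-record, next LEAD C2, REF1): the `¬ W.HasCM` binder of C2 (and of every «local class» hypothesis of this
lineage: `hNV`/`hFH`, `hWall` when read on the class) is IMPLIED by «good ordinary at `2` ∧ `W(ℚ)[2] = 0`»; sequel file
`…OrdinaryStandardShapeCMSexticNecessityCM` re-issues g36's `shapeCM_iff_crux_mod_wall{,_FH}` with `hCMex` discharged. Expected REF2:
TEXTBOOK / COROLLARY-OF-TREE. PARTITION: none; beyond-print theorem: no; BSD is NOT proved by any of this.

References: [SilvermanAEC2009] III.§1 (`c₄, c₆`), Prop. III.2.3 (points of order `2`), V.4 (ordinary ⟺ `j̃ ≠ 0` in char `2`),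
VII.5 Prop. 5.1(a), App. C §11 Examples 11.3.1–11.3.2; [SilvermanAdvancedTopics1994] App. A §3 (the thirteen CM `j`); [Lang1987]
Ch. 13 §4 Thm. 12 (Deuring); [Cremona1997] Table 1 (`49a1 = [1,−1,0,−2,−1]`, `49a2`; torsion `ℤ/2`); tree: `IsogenyHasCMIffJMemProofs`
(`hasCM_iff_j_mem_holds`), `GenusKolyvaginAtTwoMinimalTwinBSDTwoOrdinaryTwist` (gk2-p3 g6), `ResidualThetaTransportAtTwo…HabitatTwoAdicDictionary`
(rtt-p2 g7: `odd_minimalDiscriminantInt_of_hasGoodReductionAtPrime_two`), `TwoAdicImageQuadraticTwistProofs` (`hasRationalTwoTorsionX_iff_twoDivision`),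
`NoConductorOne` (`odd_c₄_int_of_odd_a₁`).
-/

set_option autoImplicit false
-- the Theorems namespace of this sub repeats the summit name by design (D-0017 nested layout)
set_option linter.dupNamespace false

noncomputable section

open scoped Classical

namespace Summit.BirchSwinnertonDyer.BirchSwinnertonDyer.Theorems.AlignedTransportAtTwoOrdinaryCMExclusion

open WeierstrassCurve Literature.NumberTheory.EllipticCurves Literature.NumberTheory.EllipticCurves.Greenberg1999
  Summit.BirchSwinnertonDyer.BirchSwinnertonDyer.Theorems.OrdinaryTwistAtTwo
  Summit.BirchSwinnertonDyer.BirchSwinnertonDyer.Theorems.ResidualThetaHabitatAtTwo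

/-! ## §1 The `2`-division cubic in `c₄, c₆` currency -/

/-- The `2`-division cubic `4x³ + b₂x² + 2b₄x + b₆` at `x = (X − 3b₂)/36` is `(X³ − 27c₄X − 54c₆)/11664`
(the classical isomorphism `X = 36x + 3b₂`, `Y = 108(2y + a₁x + a₃)` onto `Y² = X³ − 27c₄X − 54c₆`).
[cite: SilvermanAEC2009, III.§1 (the substitution giving c₄, c₆) and Prop. III.2.3] -/
theorem twoDivision_eval_eq (W : WeierstrassCurve ℚ) (X : ℚ) :
    4 * ((X - 3 * W.b₂) / 36) ^ 3 + W.b₂ * ((X - 3 * W.b₂) / 36) ^ 2 + 2 * W.b₄ * ((X - 3 * W.b₂) / 36) + W.b₆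
      = (X ^ 3 - 27 * W.c₄ * X - 54 * W.c₆) / 11664 := by
  simp only [WeierstrassCurve.c₄, WeierstrassCurve.c₆]
  ring

/-- For an elliptic `W/ℚ` with `j(W) = j₀`: `(j₀ − 1728)·c₄³ = j₀·c₆²` (from `j = c₄³/Δ` and `1728Δ = c₄³ − c₆²`). [folklore] -/
theorem c_relation_of_j_eq (W : WeierstrassCurve ℚ) [W.IsElliptic] {j₀ : ℚ} (hj : W.j = j₀) :
    (j₀ - 1728) * W.c₄ ^ 3 = j₀ * W.c₆ ^ 2 := by
  have hΔ : W.Δ ≠ 0 := W.isUnit_Δ.ne_zero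
  rw [WeierstrassCurve.j, Units.val_inv_eq_inv_val, coe_Δ'] at hj
  have hc : W.c₄ ^ 3 = j₀ * W.Δ := by
    rw [← hj]; field_simp
  have hcr := W.c_relation
  linear_combination (-1728 : ℚ) * hc + (-j₀) * hcr

/-! ## §2 The two `2`-adic-unit CM `j`-invariants carry a rational `2`-torsion point -/

/-- **Every elliptic curve over `ℚ` with `j = −3375` (CM by `ℤ[(1+√−7)/2]`; the twists of `49a1`) has a rational point of
order `2`**: the `2`-division cubic `4x³ + b₂x² + 2b₄x + b₆` vanishes at `x = (5c₆/c₄ − 3b₂)/36` (on `Y² = X³ − 27c₄X − 54c₆`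
the point `X = 5c₆/c₄`, using `189c₄³ = 125c₆²`). UNCONDITIONAL, any model. [cite: SilvermanAEC2009, Prop. III.2.3 and App. C §11 (j = −3375)] -/
theorem exists_hasRationalTwoTorsionX_of_j_eq_neg_3375 (W : WeierstrassCurve ℚ) [W.IsElliptic]
    (hj : W.j = -3375) : ∃ x : ℚ, HasRationalTwoTorsionX W x := by
  have hrel := c_relation_of_j_eq W hj
  have hΔ : W.Δ ≠ 0 := W.isUnit_Δ.ne_zero
  have hc₄ : W.c₄ ≠ 0 := by
    intro h0
    have h6 : W.c₆ = 0 := by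
      have : (-3375 : ℚ) * W.c₆ ^ 2 = 0 := by rw [← hrel, h0]; ring
      simpa using this
    apply hΔ
    have hcr := W.c_relation
    rw [h0, h6] at hcr
    linarith
  refine ⟨(5 * W.c₆ / W.c₄ - 3 * W.b₂) / 36, (hasRationalTwoTorsionX_iff_twoDivision W _).mpr ?_⟩
  rw [twoDivision_eval_eq, div_eq_zero_iff]
  left
  field_simp
  linear_combination (W.c₆ / 27) * hrel

/-- **Every elliptic curve over `ℚ` with `j = 16581375 = 255³` (CM by `ℤ[√−7]`; the twists of `49a2`) has a rational point of
order `2`**: the `2`-division cubic vanishes at `x = (−170c₆/(57c₄) − 3b₂)/36` (on `Y² = X³ − 27c₄X − 54c₆` the point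
`X = −170c₆/(57c₄)`, using `614061c₄³ = 614125c₆²`). UNCONDITIONAL, any model. [cite: SilvermanAEC2009, Prop. III.2.3 and App. C §11 (j = 255³)] -/
theorem exists_hasRationalTwoTorsionX_of_j_eq_16581375 (W : WeierstrassCurve ℚ) [W.IsElliptic]
    (hj : W.j = 16581375) : ∃ x : ℚ, HasRationalTwoTorsionX W x := by
  have hrel := c_relation_of_j_eq W hj
  have hΔ : W.Δ ≠ 0 := W.isUnit_Δ.ne_zero
  have hc₄ : W.c₄ ≠ 0 := by
    intro h0
    have h6 : W.c₆ = 0 := by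
      have : (16581375 : ℚ) * W.c₆ ^ 2 = 0 := by rw [← hrel, h0]; ring
      simpa using this
    apply hΔ
    have hcr := W.c_relation
    rw [h0, h6] at hcr
    linarith
  refine ⟨(-170 * W.c₆ / (57 * W.c₄) - 3 * W.b₂) / 36, (hasRationalTwoTorsionX_iff_twoDivision W _).mpr ?_⟩
  rw [twoDivision_eval_eq, div_eq_zero_iff]
  left
  field_simp
  linear_combination (8 * W.c₆ / 27) * hrel

/-! ## §3 Good ordinary reduction at `2` forces an odd `j` -/

/-- **On a globally minimal equation with good ORDINARY reduction at `2`, an integral `j`-invariant is odd.** Ordinary at `2` ⟺ `a₁`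
odd (`isOrdinaryAt_two_iff_odd_a₁`, Silverman V.4: supersingular in characteristic `2` ⟺ `j̃ = ā₁¹²/Δ̃ = 0`) ⟹ `c₄ ≡ b₂² ≡ a₁⁴` odd;
good at `2` ⟹ `Δ_min` odd; and `j·Δ_min = c₄³` in `ℤ`. [cite: SilvermanAEC2009, V.4 (first paragraph) and VII.5 Prop. 5.1(a)] -/
theorem odd_of_isOrdinaryAt_two_of_j_eq_intCast (W : WeierstrassCurve ℚ) [W.IsElliptic] [W.IsGloballyMinimal]
    (hord : IsOrdinaryAt W 2) {n : ℤ} (hj : W.j = n) : Odd n := by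
  have hgood : W.HasGoodReductionAtPrime 2 := hord.1
  have ha₁ : Odd (integralModelInt W).a₁ := (isOrdinaryAt_two_iff_odd_a₁ W hgood).mp hord
  have hc₄ : Odd (integralModelInt W).c₄ := (integralModelInt W).odd_c₄_int_of_odd_a₁ ha₁
  have hΔ : Odd (minimalDiscriminantInt W) := odd_minimalDiscriminantInt_of_hasGoodReductionAtPrime_two W hgood
  have hΔ0 : W.Δ ≠ 0 := W.isUnit_Δ.ne_zero
  rw [WeierstrassCurve.j, Units.val_inv_eq_inv_val, coe_Δ'] at hj
  have hc : W.c₄ ^ 3 = n * W.Δ := by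
    rw [← hj]; field_simp
  rw [← intCast_c₄_integralModelInt, ← cast_minimalDiscriminantInt] at hc
  have hcz : (integralModelInt W).c₄ ^ 3 = n * minimalDiscriminantInt W := by exact_mod_cast hc
  have h3 : Odd (n * minimalDiscriminantInt W) := hcz ▸ hc₄.pow
  exact (Int.odd_mul.mp h3).1

/-! ## §4 Deuring at `2` in `j`-currency, the rational `2`-torsion of ordinary CM curves, and the CM exclusion -/

/-- **Deuring at `2` for CM curves over `ℚ`, in `j`-currency.** A globally minimal CM elliptic curve over `ℚ` with good ORDINARY reduction
at `2` has `j ∈ {−3375, 16581375}` (CM field `ℚ(√−7)`, the only class-number-one field in which `2` splits). Proof: by the tree THEOREM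
`hasCM_iff_j_mem_holds` (Silverman App. C §11 — Heegner–Stark–Baker, kernel-checked in the tree) `j(W)` is one of thirteen integers, and the
other eleven (`0, 1728, 8000, −32768, 54000, 287496, −884736, −12288000, −884736000, −147197952000, −262537412640768000`) are even,
impossible at good ordinary `2` (§3). UNCONDITIONAL. [cite: SilvermanAEC2009, App. C §11 Examples 11.3.1–11.3.2 and V.4]
[cite: Lang1987, Ch. 13 §4 Thm. 12] -/
theorem j_eq_or_j_eq_of_hasCM_of_isOrdinaryAt_two (W : WeierstrassCurve ℚ) [W.IsElliptic] [W.IsGloballyMinimal]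
    (hCM : W.HasCM) (hord : IsOrdinaryAt W 2) : W.j = -3375 ∨ W.j = 16581375 := by
  have hj := (hasCM_iff_j_mem_holds W).mp hCM
  have hodd : ∀ n : ℤ, W.j = n → Odd n := fun n h ↦ odd_of_isOrdinaryAt_two_of_j_eq_intCast W hord h
  simp only [cmJInvariants, Finset.mem_insert, Finset.mem_singleton] at hj
  rcases hj with h | h | h | h | h | h | h | h | h | h | h | h | h
  · exact absurd (hodd 0 (by rw [h]; norm_num)) (by decide)
  · exact absurd (hodd 1728 (by rw [h]; norm_num)) (by decide)
  · exact Or.inl h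
  · exact absurd (hodd 8000 (by rw [h]; norm_num)) (by decide)
  · exact absurd (hodd (-32768) (by rw [h]; norm_num)) (by decide)
  · exact absurd (hodd 54000 (by rw [h]; norm_num)) (by decide)
  · exact absurd (hodd 287496 (by rw [h]; norm_num)) (by decide)
  · exact absurd (hodd (-884736) (by rw [h]; norm_num)) (by decide)
  · exact absurd (hodd (-12288000) (by rw [h]; norm_num)) (by decide)
  · exact Or.inr h
  · exact absurd (hodd (-884736000) (by rw [h]; norm_num)) (by decide)
  · exact absurd (hodd (-147197952000) (by rw [h]; norm_num)) (by decide)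
  · exact absurd (hodd (-262537412640768000) (by rw [h]; norm_num)) (by decide)

/-- **A CM elliptic curve over `ℚ` with good ORDINARY reduction at `2` has a rational point of order `2`** (it is a twist of `49a1` or
`49a2`: `j ∈ {−3375, 16581375}` and §2). UNCONDITIONAL. [cite: SilvermanAEC2009, App. C §11 Examples 11.3.1–11.3.2 and Prop. III.2.3] -/
theorem exists_hasRationalTwoTorsionX_of_hasCM_of_isOrdinaryAt_two (W : WeierstrassCurve ℚ) [W.IsElliptic] [W.IsGloballyMinimal]
    (hCM : W.HasCM) (hord : IsOrdinaryAt W 2) : ∃ x : ℚ, HasRationalTwoTorsionX W x := by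
  rcases j_eq_or_j_eq_of_hasCM_of_isOrdinaryAt_two W hCM hord with h | h
  · exact exists_hasRationalTwoTorsionX_of_j_eq_neg_3375 W h
  · exact exists_hasRationalTwoTorsionX_of_j_eq_16581375 W h

/-- **THE CM EXCLUSION (att-p4 g36's displayed hypothesis `hCMex`, PROVED).** A globally minimal elliptic curve over `ℚ` with good ORDINARY
reduction at `2` and no rational point of order `2` has NO complex multiplication (contrapositive of
`exists_hasRationalTwoTorsionX_of_hasCM_of_isOrdinaryAt_two`). `Δ ∉ ℚ²` is not needed. UNCONDITIONAL.
[cite: SilvermanAEC2009, App. C §11 Examples 11.3.1–11.3.2, V.4 and Prop. III.2.3] -/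
theorem not_hasCM_of_isOrdinaryAt_two_of_forall_not_hasRationalTwoTorsionX
    (W : WeierstrassCurve ℚ) [W.IsElliptic] [W.IsGloballyMinimal] (hord : IsOrdinaryAt W 2)
    (ht : ∀ x : ℚ, ¬ HasRationalTwoTorsionX W x) : ¬ W.HasCM := fun hCM ↦ by
  obtain ⟨x, hx⟩ := exists_hasRationalTwoTorsionX_of_hasCM_of_isOrdinaryAt_two W hCM hord
  exact ht x hx

/-- The CM exclusion in the `GoodOrd` currency of `Literature.…Rank1Residual.Predicates` (routes `ByReductionTypeAtTwo`, `GenusKolyvaginAtTwo`, the X5 leaves):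
a globally minimal elliptic `W/ℚ` with `GoodOrd W 2` and `W(ℚ)[2] = 0` is non-CM (`GoodOrd W 2` and `IsOrdinaryAt W 2` have the same body).
[cite: SilvermanAEC2009, App. C §11 Examples 11.3.1–11.3.2] -/
theorem not_hasCM_of_goodOrd_two_of_forall_not_hasRationalTwoTorsionX
    (W : WeierstrassCurve ℚ) [W.IsElliptic] [W.IsGloballyMinimal] (hord : Rank1Residual.GoodOrd W 2)
    (ht : ∀ x : ℚ, ¬ HasRationalTwoTorsionX W x) : ¬ W.HasCM :=
  not_hasCM_of_isOrdinaryAt_two_of_forall_not_hasRationalTwoTorsionX W ⟨hord.1, hord.2⟩ ht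

/-- In `GoodOrd` currency: a globally minimal CM elliptic curve over `ℚ` with `GoodOrd W 2` has a rational point of order `2` (and
`j ∈ {−3375, 16581375}`). [cite: SilvermanAEC2009, App. C §11 Examples 11.3.1–11.3.2 and Prop. III.2.3] -/
theorem exists_hasRationalTwoTorsionX_of_hasCM_of_goodOrd_two (W : WeierstrassCurve ℚ) [W.IsElliptic] [W.IsGloballyMinimal]
    (hCM : W.HasCM) (hord : Rank1Residual.GoodOrd W 2) : ∃ x : ℚ, HasRationalTwoTorsionX W x :=
  exists_hasRationalTwoTorsionX_of_hasCM_of_isOrdinaryAt_two W hCM ⟨hord.1, hord.2⟩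

/-- **The CM exclusion in the exact shape of the displayed hypothesis `hCMex`** of
`…OrdinaryStandardShapeCMSexticNecessity.shapeCM_iff_crux_mod_wall` / `…NecessityFH.shapeCM_iff_crux_mod_wall_FH` (att-p4 g36), and of the
binders of crux C2 `MainConjectureOfRankZeroBSDAtTwo`: «`IsOrdinaryAt W 2 → W(ℚ)[2] = 0 → Δ ∉ ℚ² → ¬CM`» for every globally minimal elliptic
`W/ℚ` — now a theorem (the `Δ` binder is idle). So the `¬ W.HasCM` binder of C2 is implied by its next two binders.
[cite: SilvermanAEC2009, App. C §11 Examples 11.3.1–11.3.2] -/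
theorem cmExclusion :
    ∀ (W : WeierstrassCurve ℚ) [W.IsElliptic] [W.IsGloballyMinimal], IsOrdinaryAt W 2 →
      (∀ x : ℚ, ¬ HasRationalTwoTorsionX W x) → ¬ IsSquare W.Δ → ¬ W.HasCM :=
  fun W _ _ hord ht _ ↦ not_hasCM_of_isOrdinaryAt_two_of_forall_not_hasRationalTwoTorsionX W hord ht

end Summit.BirchSwinnertonDyer.BirchSwinnertonDyer.Theorems.AlignedTransportAtTwoOrdinaryCMExclusion

end
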